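import Summits.CriticalPhenomena.PercolationContinuityZ3.Theorems.Transplant.StatementCubicLattices
import Summits.CriticalPhenomena.PercolationContinuityZ3.Theorems.Transplant.StatementBenjaminiSchramm
import Summits.CriticalPhenomena.PercolationContinuityZ3.Theorems.Transplant.LatticeCriticalProbLtOne
import Mathlib.Tactic.FinCases
import HarnessLib

/-!
# The fcc and bcc lattices are in the scope of Conjecture 4: locally finite, connected, transitive, `p_c < 1`

builds on p205010 (kernel theorem, internal audit signed; external expert review pending).
Status sentence (coordinator 2026-08-20T04:30Z): "θ(p_c) = 0 on ℤ^d, all d ≥ 2 — kernel-verified (Lean 4/Mathlib,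
standard axioms); internal adversarial audit SIGNED 2026-08-20 04:29Z; external expert review pending."

Structure lemmas (lane `prim-bschramm-*`, seat `prim-bschramm-stmt`) completing the non-vacuity record of `StatementCubicLattices.lean`:
* `distSqGraph_locallyFinite` — every `distSqGraph d m` is locally finite (a neighbour `y` of `x` has `|x_i - y_i| ≤ (x_i - y_i)² ≤ m` in each
  coordinate); hence instances `fccGraph.LocallyFinite`, `bccGraph.LocallyFinite`;
* `reachable_add_zsmul` — in a graph on an additive subgroup `S ≤ ℤ^d` in which `v ∼ v + g` for every `v`, every `v + n•g` is reachable from `v`;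
* `fccGraph_connected` — `D₃` is generated by the minimal vectors `(1,1,0), (1,0,1), (0,1,1)`: `(a,b,c) = (k-c)(1,1,0) + (k-b)(1,0,1) + (k-a)(0,1,1)`
  when `a+b+c = 2k`; `bccGraph_connected` — `2·D₃*` is generated by `(1,1,1), (1,1,-1), (1,-1,1)`;
* `fcc_conj4_hypotheses`, `bcc_conj4_hypotheses` — connected ∧ `Aut`-transitive ∧ quasi-transitive ∧ `p_c < 1`; hence
  `fccOwnCriticalContinuity_of_conj4`, `bccOwnCriticalContinuity_of_conj4` — Conjecture 4 implies both targets.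
-/

noncomputable section

namespace Summit.CriticalPhenomena.PercolationContinuityZ3.Theorems.Transplant

open MeasureTheory Literature.Probability.Percolation Literature.Probability.LatticeModels
open Literature.Barriers.CriticalPhenomena (IsQuasiTransitive)

/-! ## Local finiteness -/

/-- A neighbour in `distSqGraph d m` differs by at most `m` in each coordinate (`|t| ≤ t² ≤ Σ = m` for the integer `t = x_i - y_i`;
cf. the tree's `Tunnell1983.abs_le_sq`). [folklore] -/
theorem distSqGraph_adj_coord_bound {d : ℕ} {m : ℤ} {x y : Site d} (h : (distSqGraph d m).Adj x y) (i : Fin d) :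
    |x i - y i| ≤ m := by
  have hle : (x i - y i) ^ 2 ≤ ∑ j, (x j - y j) ^ 2 :=
    Finset.single_le_sum (f := fun j => (x j - y j) ^ 2) (fun j _ => sq_nonneg _) (Finset.mem_univ i)
  rw [h.2] at hle
  rcases eq_or_ne (x i - y i) 0 with ht | ht
  · rw [ht, abs_zero]; rw [ht] at hle; simpa using hle
  · have h1 : 1 ≤ |x i - y i| := Int.one_le_abs ht
    nlinarith [abs_nonneg (x i - y i), sq_abs (x i - y i)]

/-- `distSqGraph d m` is locally finite: the neighbours of `x` lie in the box `Π_i [x_i - m, x_i + m]`. [folklore] -/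
instance distSqGraph_locallyFinite (d : ℕ) (m : ℤ) : (distSqGraph d m).LocallyFinite := by
  intro x
  refine Set.Finite.fintype ((Set.Finite.pi' (t := fun i : Fin d => Set.Icc (x i - m) (x i + m))
    fun i => Set.finite_Icc _ _).subset ?_)
  intro y hy
  rw [SimpleGraph.mem_neighborSet] at hy
  simp only [Set.mem_Icc]
  intro i
  have := distSqGraph_adj_coord_bound hy i
  rw [abs_le] at this
  exact ⟨by linarith, by linarith⟩

/-- Induced subgraphs of `distSqGraph` on a vertex set are locally finite. [folklore] -/
instance distSqGraph_induce_locallyFinite (d : ℕ) (m : ℤ) (s : Set (Site d)) : ((distSqGraph d m).induce s).LocallyFinite := fun x =>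
  ((((distSqGraph d m).neighborSet x.1).toFinite.preimage Subtype.val_injective.injOn).subset
    fun y (hy : ((distSqGraph d m).induce s).Adj x y) => by simpa [SimpleGraph.mem_neighborSet] using hy).fintype

/-- The fcc lattice is locally finite (degree 12). [cite: ConwaySloane1999, Ch. 4 §7.1] -/
instance fccGraph_locallyFinite : fccGraph.LocallyFinite := distSqGraph_induce_locallyFinite 3 2 fccSite

/-- The bcc lattice is locally finite (degree 8). [cite: ConwaySloane1999, Ch. 4 §7.1] -/
instance bccGraph_locallyFinite : bccGraph.LocallyFinite := distSqGraph_induce_locallyFinite 3 3 bccSite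

/-! ## Reachability along a generator -/

/-- In the induced distance graph on an additive subgroup `S ≤ ℤ^d`: if `v ∼ v + g` for every `v`, then `v + n•g` is reachable from `v` for every
integer `n`. [folklore] -/
theorem reachable_add_zsmul {d : ℕ} {m : ℤ} (S : AddSubgroup (Site d)) (g : S)
    (hadj : ∀ v : S, ((distSqGraph d m).induce (S : Set (Site d))).Adj v (v + g)) (v : S) (n : ℤ) :
    ((distSqGraph d m).induce (S : Set (Site d))).Reachable v (v + n • g) := by
  induction n using Int.induction_on with
  | zero => simp
  | succ k ih =>
    refine ih.trans (SimpleGraph.Adj.reachable ?_)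
    have := hadj (v + (k : ℤ) • g)
    rwa [add_assoc, ← add_one_zsmul] at this
  | pred k ih =>
    refine ih.trans (SimpleGraph.Adj.reachable ?_)
    have := (hadj (v + (-(k : ℤ) - 1) • g)).symm
    rwa [add_assoc, ← add_one_zsmul, sub_add_cancel] at this

/-- A vector `g ∈ S` with `‖g‖² = m ≠ 0` is a step of the induced distance graph at every vertex: `v ∼ v + g`. [folklore] -/
theorem induce_adj_add_of_normSq {d : ℕ} {m : ℤ} (hm : m ≠ 0) (S : AddSubgroup (Site d)) (g : S)
    (hg : ∑ i, ((g : Site d) i) ^ 2 = m) (v : S) :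
    ((distSqGraph d m).induce (S : Set (Site d))).Adj v (v + g) := by
  show (distSqGraph d m).Adj (v : Site d) ((v : Site d) + (g : Site d))
  refine ⟨fun h => ?_, ?_⟩
  · have hg0 : (g : Site d) = 0 := by
      have := congrArg (fun w => w - (v : Site d)) h
      simpa using this.symm
    apply hm
    rw [← hg, hg0]
    simp
  · rw [← hg]
    exact Finset.sum_congr rfl fun i _ => by simp only [Pi.add_apply]; ring

/-! ## fcc is connected -/

/-- The minimal vector `(1,1,0) ∈ D₃`. [cite: ConwaySloane1999, Ch. 4 §7.1] -/
def fccGen1 : fccSubgroup := ⟨![1, 1, 0], by show Even ((![1, 1, 0] : Site 3) 0 + (![1, 1, 0] : Site 3) 1 + (![1, 1, 0] : Site 3) 2); decide⟩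
/-- The minimal vector `(1,0,1) ∈ D₃`. [cite: ConwaySloane1999, Ch. 4 §7.1] -/
def fccGen2 : fccSubgroup := ⟨![1, 0, 1], by show Even ((![1, 0, 1] : Site 3) 0 + (![1, 0, 1] : Site 3) 1 + (![1, 0, 1] : Site 3) 2); decide⟩
/-- The minimal vector `(0,1,1) ∈ D₃`. [cite: ConwaySloane1999, Ch. 4 §7.1] -/
def fccGen3 : fccSubgroup := ⟨![0, 1, 1], by show Even ((![0, 1, 1] : Site 3) 0 + (![0, 1, 1] : Site 3) 1 + (![0, 1, 1] : Site 3) 2); decide⟩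

/-- **The fcc lattice is connected**: every `(a,b,c) ∈ D₃` with `a+b+c = 2k` equals `(k-c)·(1,1,0) + (k-b)·(1,0,1) + (k-a)·(0,1,1)`, and each generator is an
edge step. [cite: ConwaySloane1999, Ch. 4 §7.1 (D_n is generated by its minimal vectors)] -/
theorem fccGraph_connected : fccGraph.Connected := by
  have h1 : ∀ v : fccSubgroup, fccGraph.Adj v (v + fccGen1) :=
    induce_adj_add_of_normSq (by norm_num) fccSubgroup fccGen1 (by simp [fccGen1, Fin.sum_univ_three])
  have h2 : ∀ v : fccSubgroup, fccGraph.Adj v (v + fccGen2) :=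
    induce_adj_add_of_normSq (by norm_num) fccSubgroup fccGen2 (by simp [fccGen2, Fin.sum_univ_three])
  have h3 : ∀ v : fccSubgroup, fccGraph.Adj v (v + fccGen3) :=
    induce_adj_add_of_normSq (by norm_num) fccSubgroup fccGen3 (by simp [fccGen3, Fin.sum_univ_three])
  haveI : Nonempty fccSite := ⟨fccOrigin⟩
  refine SimpleGraph.Connected.mk fun x y => ?_
  -- it suffices to reach every vertex from the origin
  suffices hreach : ∀ z : fccSubgroup, fccGraph.Reachable (0 : fccSubgroup) z from
    (hreach x).symm.trans (hreach y)
  intro z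
  obtain ⟨k, hk⟩ := (mem_fccSite_iff (z : Site 3)).1 z.2
  -- z = (k - c)•g1 + (k - b)•g2 + (k - a)•g3 with (a,b,c) = z
  have hz : z = (0 : fccSubgroup) + (k - (z : Site 3) 2) • fccGen1 + (k - (z : Site 3) 1) • fccGen2 + (k - (z : Site 3) 0) • fccGen3 := by
    apply Subtype.ext
    funext i
    simp only [AddSubgroup.coe_add, AddSubgroup.coe_zero, AddSubgroupClass.coe_zsmul, fccGen1, fccGen2, fccGen3, Pi.add_apply,
      Pi.smul_apply, Pi.zero_apply, smul_eq_mul]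
    fin_cases i <;> simp <;> linarith
  rw [hz]
  exact ((reachable_add_zsmul fccSubgroup fccGen1 h1 0 _).trans
    (reachable_add_zsmul fccSubgroup fccGen2 h2 _ _)).trans (reachable_add_zsmul fccSubgroup fccGen3 h3 _ _)

/-! ## bcc is connected -/

/-- The nearest-neighbour vector `(1,1,1) ∈ 2·D₃*`. [cite: ConwaySloane1999, Ch. 4 §7.1] -/
def bccGen1 : bccSubgroup := ⟨![1, 1, 1], Or.inr fun i => by fin_cases i <;> decide⟩
/-- The nearest-neighbour vector `(1,1,-1) ∈ 2·D₃*`. [cite: ConwaySloane1999, Ch. 4 §7.1] -/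
def bccGen2 : bccSubgroup := ⟨![1, 1, -1], Or.inr fun i => by fin_cases i <;> decide⟩
/-- The nearest-neighbour vector `(1,-1,1) ∈ 2·D₃*`. [cite: ConwaySloane1999, Ch. 4 §7.1] -/
def bccGen3 : bccSubgroup := ⟨![1, -1, 1], Or.inr fun i => by fin_cases i <;> decide⟩

/-- **The bcc lattice is connected**: `2·D₃*` is generated by `(1,1,1), (1,1,-1), (1,-1,1)`:
`(a,b,c) = ((b+c)/2)·(1,1,1) + ((a-c)/2)·(1,1,-1) + ((a-b)/2)·(1,-1,1)` (integral since `a ≡ b ≡ c (mod 2)`), and each generator is an edge step.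
[cite: ConwaySloane1999, Ch. 4 §7.1] -/
theorem bccGraph_connected : bccGraph.Connected := by
  have h1 : ∀ v : bccSubgroup, bccGraph.Adj v (v + bccGen1) :=
    induce_adj_add_of_normSq (by norm_num) bccSubgroup bccGen1 (by simp [bccGen1, Fin.sum_univ_three])
  have h2 : ∀ v : bccSubgroup, bccGraph.Adj v (v + bccGen2) :=
    induce_adj_add_of_normSq (by norm_num) bccSubgroup bccGen2 (by simp [bccGen2, Fin.sum_univ_three])
  have h3 : ∀ v : bccSubgroup, bccGraph.Adj v (v + bccGen3) :=
    induce_adj_add_of_normSq (by norm_num) bccSubgroup bccGen3 (by simp [bccGen3, Fin.sum_univ_three])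
  haveI : Nonempty bccSite := ⟨bccOrigin⟩
  refine SimpleGraph.Connected.mk fun x y => ?_
  suffices hreach : ∀ z : bccSubgroup, bccGraph.Reachable (0 : bccSubgroup) z from
    (hreach x).symm.trans (hreach y)
  intro z
  -- coefficients: α = (b+c)/2, β = (a-c)/2, γ = (a-b)/2
  obtain ⟨α, β, γ, hα, hβ, hγ⟩ : ∃ α β γ : ℤ, (z : Site 3) 1 + (z : Site 3) 2 = 2 * α ∧ (z : Site 3) 0 - (z : Site 3) 2 = 2 * β ∧
      (z : Site 3) 0 - (z : Site 3) 1 = 2 * γ := by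
    rcases (mem_bccSite_iff (z : Site 3)).1 z.2 with h | h
    · obtain ⟨a, ha⟩ := h 0
      obtain ⟨b, hb⟩ := h 1
      obtain ⟨c, hc⟩ := h 2
      exact ⟨b + c, a - c, a - b, by rw [hb, hc]; ring, by rw [ha, hc]; ring, by rw [ha, hb]; ring⟩
    · obtain ⟨a, ha⟩ := h 0
      obtain ⟨b, hb⟩ := h 1
      obtain ⟨c, hc⟩ := h 2
      exact ⟨b + c + 1, a - c, a - b, by rw [hb, hc]; ring, by rw [ha, hc]; ring, by rw [ha, hb]; ring⟩
  have hz : z = (0 : bccSubgroup) + α • bccGen1 + β • bccGen2 + γ • bccGen3 := by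
    apply Subtype.ext
    funext i
    simp only [AddSubgroup.coe_add, AddSubgroup.coe_zero, AddSubgroupClass.coe_zsmul, bccGen1, bccGen2, bccGen3, Pi.add_apply,
      Pi.smul_apply, Pi.zero_apply, smul_eq_mul]
    fin_cases i <;> simp <;> linarith
  rw [hz]
  exact ((reachable_add_zsmul bccSubgroup bccGen1 h1 0 _).trans
    (reachable_add_zsmul bccSubgroup bccGen2 h2 _ _)).trans (reachable_add_zsmul bccSubgroup bccGen3 h3 _ _)

/-! ## In scope of Conjecture 4 -/

/-- **The fcc lattice meets every hypothesis of Conjecture 4**: connected, locally finite (instance), `Aut`-transitive (hence quasi-transitive), and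
`p_c(fcc) < 1`. [cite: BenjaminiSchramm1996, Conj. 4] -/
theorem fcc_conj4_hypotheses :
    fccGraph.Connected ∧ MulAction.IsPretransitive (fccGraph ≃g fccGraph) fccSite ∧ IsQuasiTransitive fccGraph ∧
      criticalProb fccGraph fccOrigin < 1 :=
  ⟨fccGraph_connected, isPretransitive_aut_fcc, isQuasiTransitive_of_isPretransitive fccGraph fccOrigin isPretransitive_aut_fcc,
    criticalProb_fcc_lt_one⟩

/-- **The bcc lattice meets every hypothesis of Conjecture 4.** [cite: BenjaminiSchramm1996, Conj. 4] -/
theorem bcc_conj4_hypotheses :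
    bccGraph.Connected ∧ MulAction.IsPretransitive (bccGraph ≃g bccGraph) bccSite ∧ IsQuasiTransitive bccGraph ∧
      criticalProb bccGraph bccOrigin < 1 :=
  ⟨bccGraph_connected, isPretransitive_aut_bcc, isQuasiTransitive_of_isPretransitive bccGraph bccOrigin isPretransitive_aut_bcc,
    criticalProb_bcc_lt_one⟩

/-- **Conjecture 4 implies the fcc target.** [cite: BenjaminiSchramm1996, Conj. 4] -/
theorem fccOwnCriticalContinuity_of_conj4 (h : BenjaminiSchramm1996_conj4) : FccOwnCriticalContinuity :=
  h fccGraph fccGraph_connected (isQuasiTransitive_of_isPretransitive fccGraph fccOrigin isPretransitive_aut_fcc) fccOrigin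
    criticalProb_fcc_lt_one

/-- **Conjecture 4 implies the bcc target.** [cite: BenjaminiSchramm1996, Conj. 4] -/
theorem bccOwnCriticalContinuity_of_conj4 (h : BenjaminiSchramm1996_conj4) : BccOwnCriticalContinuity :=
  h bccGraph bccGraph_connected (isQuasiTransitive_of_isPretransitive bccGraph bccOrigin isPretransitive_aut_bcc) bccOrigin
    criticalProb_bcc_lt_one

end Summit.CriticalPhenomena.PercolationContinuityZ3.Theorems.Transplant
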